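import Summits.CriticalPhenomena.PercolationContinuityZ3.Theorems.PercNearOneGluingNoHeavyLowerTailOneCutModulus
import Summits.CriticalPhenomena.PercolationContinuityZ3.Theorems.PercNearOneGluingNoHeavyLowerTailCILReduction
import HarnessLib

/-!
# `NoHeavyLowerTail` (stmt-CriticalPhenomena-4575) — the GEOMETRIC-MOMENT form of the cumulative isolation
# lemma (≡ event gluing towards a UNIFORM VIRTUAL STAR SINK) with ANY constant closes the crux

Typed reduction (lead of the one-cut line, gen 4; `--supports stmt-CriticalPhenomena-4575`).  No definitions,
no named facts, no sorries.

Notation: `μ = prodBernoulli w` on `Fin n`, relay set `A` (`k = |A|`), observer `o ∉ A`,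
`π(x) = {a ∈ A : x ↔ a}`, `N = |π(o)|`.  For a parameter `v ∈ (0, 1]` consider the two polynomials

  `L(v) = Σ_{j ≥ 1} v^j · P(N = j) = E[v^N ; N ≥ 1]`,     `R_a(v) = Σ_{j ≥ 0} v^j · P(|π(a)| = j) = E[v^{|π(a)|}]`.

**GM-CIL(C)** (geometric-moment cumulative isolation with constant `C`): for every finite weighted graph,
every nonempty `A`, every `o ∉ A` and every `v ∈ (0,1]` there is a relay `a ∈ A` with `L(v) ≤ C · R_a(v)`.

* `noHeavyLowerTail_of_geometricMomentCIL` — **GM-CIL(C) for some `C ≥ 0` implies the crux.**  Proof: with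
  `J = ⌊k/4⌋` and `h = ⌊k/2⌋ + 1`, `v^J · P(1 ≤ N ≤ J) ≤ L(v)` (`GeomMomentCIL.pow_mul_window_le_momentSum`)
  and `R_a(v) ≤ P(2|π(a)| ≤ k) + v^h ≤ 2τ + v^{2J}` (`GeomMomentCIL.momentSum_le_small_add_pow`, pair counting
  `Theorems.smallBlock_le_two_mul`); choosing `v = s^{1/J}` gives `P(1 ≤ N ≤ k/4) ≤ C (2τ/s + s)`, a one-cut
  bound with modulus at level `ρ = 1/4`, and `Theorems.noHeavyLowerTail_of_oneCut_modulus` concludes.  So the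
  LEVEL-wise maximum principle `CIL_j` (open, sharp constant) may be replaced by ONE smooth inequality between
  two polynomials in `v`, with the maximising relay allowed to depend on `v`, and with any constant.

WHY THIS SHAPE (not formalised here; three lines each, lead memo LEAD-GEN4 §5):
* `R_a(v) = P(a ↮ b)` and `L(v) = P(o ↔ A, o ↮ b)` in the graph obtained by attaching a NEW vertex `b` to every
  relay by independent edges of the common weight `q = 1 − v` (a "uniform virtual star sink": `o ↔ A` is decided
  inside the original graph because `b` is adjacent only to relays, and `x ↮ b` iff every relay of `x`'s cluster
  has its `b`-edge closed).  Hence GM-CIL(C) is EXACTLY event gluing with constant `C`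
  (`P(o ↔ A, o ↮ b) ≤ C · max_a P(a ↮ b)`, cf. `Theorems.noHeavyLowerTail_of_eventGluingConst`, which needs it for
  ALL graphs) restricted to graphs whose sink is a uniform star on the relays — in particular `A` separates `o`
  from `b`, the setting of Kozma–Nitzan's Theorem 3 (`Literature.Probability.Percolation.KozmaNitzan2024_thm3`,
  arXiv:2401.12397 Thm 3), which proves GM-CIL(1) for `|A| = 3`; the coefficient of `v¹` is the lonely-relay
  lemma `Theorems.lonelyRelay` (all `k`); `v → 1⁻` recovers the mean-connection form of
  `…NoHeavyLowerTailOneCutModulus`.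
* Equivalently, with a random set `H ⊆ A` of "hot" relays (each relay hot independently with probability
  `1 − v`): `P(o ↔ A, π(o) ∩ H = ∅) ≤ C · max_a P(π(a) ∩ H = ∅)` — event gluing towards a Poissonised random glued
  relay target; the reduction uses `|H| ≈ 4 log(1/s)` hot relays, independent of `k`.
-/

noncomputable section

namespace Summit.CriticalPhenomena.PercolationContinuityZ3.Theorems

open MeasureTheory Set Literature.Probability.LatticeModels Literature.Probability.Percolation
open Summit.CriticalPhenomena.PercolationContinuityZ3.Theses.PercNearOneGluing
open scoped Classical BigOperators

namespace GeomMomentCIL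

variable {n : ℕ}

/-- Level sums are the measure of the corresponding super-level event: for a probability measure `μ` on bond
configurations, an `ℕ`-valued statistic `M` and a finite set of levels `S`,
`Σ_{j ∈ S} μ{M = j} = μ{M ∈ S}`. -/
theorem sum_measureReal_level_eq (μ : Measure (BondConfig (Fin n))) [IsFiniteMeasure μ]
    (M : BondConfig (Fin n) → ℕ) (S : Finset ℕ) :
    ∑ j ∈ S, μ.real {ω : BondConfig (Fin n) | M ω = j} = μ.real {ω : BondConfig (Fin n) | M ω ∈ S} := by
  have hd : Set.PairwiseDisjoint (↑S : Set ℕ) (fun j => {ω : BondConfig (Fin n) | M ω = j}) := by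
    intro i _ j _ hij
    change Disjoint {ω : BondConfig (Fin n) | M ω = i} {ω : BondConfig (Fin n) | M ω = j}
    exact Set.disjoint_left.2 fun ω hi hj => hij (hi.symm.trans hj)
  have hU : (⋃ j ∈ S, {ω : BondConfig (Fin n) | M ω = j}) = {ω : BondConfig (Fin n) | M ω ∈ S} := by
    ext ω
    simp only [Set.mem_iUnion, Set.mem_setOf_eq, exists_prop, exists_eq_right']
  rw [← hU, measureReal_biUnion_finset hd (fun j _ => MeasurableSet.of_discrete)]

/-- **Lower truncation.**  For `0 ≤ v ≤ 1` and `J ≤ k`:  `v^J · μ{1 ≤ M ≤ J} ≤ Σ_{j=1}^{k} v^j μ{M = j}`. -/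
theorem pow_mul_window_le_momentSum (μ : Measure (BondConfig (Fin n))) [IsFiniteMeasure μ]
    (M : BondConfig (Fin n) → ℕ) (v : ℝ) (hv0 : 0 ≤ v) (hv1 : v ≤ 1) (J k : ℕ) (hJk : J ≤ k) :
    v ^ J * μ.real {ω : BondConfig (Fin n) | 1 ≤ M ω ∧ M ω ≤ J} ≤
      ∑ j ∈ Finset.Icc 1 k, v ^ j * μ.real {ω : BondConfig (Fin n) | M ω = j} := by
  have hwin : μ.real {ω : BondConfig (Fin n) | 1 ≤ M ω ∧ M ω ≤ J} =
      ∑ j ∈ Finset.Icc 1 J, μ.real {ω : BondConfig (Fin n) | M ω = j} := by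
    rw [sum_measureReal_level_eq μ M (Finset.Icc 1 J)]
    congr 1
    ext ω
    simp only [Set.mem_setOf_eq, Finset.mem_Icc]
  rw [hwin, Finset.mul_sum]
  calc ∑ j ∈ Finset.Icc 1 J, v ^ J * μ.real {ω : BondConfig (Fin n) | M ω = j}
      ≤ ∑ j ∈ Finset.Icc 1 J, v ^ j * μ.real {ω : BondConfig (Fin n) | M ω = j} := by
        refine Finset.sum_le_sum fun j hj => ?_
        have hjJ : j ≤ J := (Finset.mem_Icc.1 hj).2
        exact mul_le_mul_of_nonneg_right (pow_le_pow_of_le_one hv0 hv1 hjJ) measureReal_nonneg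
    _ ≤ ∑ j ∈ Finset.Icc 1 k, v ^ j * μ.real {ω : BondConfig (Fin n) | M ω = j} :=
        Finset.sum_le_sum_of_subset_of_nonneg (Finset.Icc_subset_Icc_right hJk)
          fun j _ _ => mul_nonneg (pow_nonneg hv0 j) measureReal_nonneg

/-- **Upper truncation.**  For `0 ≤ v ≤ 1`, a probability measure and any threshold `h`:
`Σ_{j=0}^{k} v^j μ{M = j} ≤ μ{M < h} + v^h`. -/
theorem momentSum_le_small_add_pow (μ : Measure (BondConfig (Fin n))) [IsProbabilityMeasure μ]
    (M : BondConfig (Fin n) → ℕ) (v : ℝ) (hv0 : 0 ≤ v) (hv1 : v ≤ 1) (k h : ℕ) :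
    ∑ j ∈ Finset.range (k + 1), v ^ j * μ.real {ω : BondConfig (Fin n) | M ω = j} ≤
      μ.real {ω : BondConfig (Fin n) | M ω < h} + v ^ h := by
  rw [← Finset.sum_filter_add_sum_filter_not (Finset.range (k + 1)) (fun j => j < h)]
  refine add_le_add ?_ ?_
  · -- low levels: `v^j ≤ 1`, and the level sets lie inside `{M < h}`
    calc ∑ j ∈ (Finset.range (k + 1)).filter (fun j => j < h),
          v ^ j * μ.real {ω : BondConfig (Fin n) | M ω = j}
        ≤ ∑ j ∈ (Finset.range (k + 1)).filter (fun j => j < h),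
            μ.real {ω : BondConfig (Fin n) | M ω = j} := by
          refine Finset.sum_le_sum fun j _ => ?_
          have h1 : v ^ j * μ.real {ω : BondConfig (Fin n) | M ω = j} ≤
              1 * μ.real {ω : BondConfig (Fin n) | M ω = j} :=
            mul_le_mul_of_nonneg_right (pow_le_one₀ hv0 hv1) measureReal_nonneg
          simpa using h1
      _ = μ.real {ω : BondConfig (Fin n) | M ω ∈ (Finset.range (k + 1)).filter (fun j => j < h)} :=
          sum_measureReal_level_eq μ M _
      _ ≤ μ.real {ω : BondConfig (Fin n) | M ω < h} := by
          refine measureReal_mono (fun ω hω => ?_) (measure_ne_top _ _)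
          simp only [Set.mem_setOf_eq, Finset.mem_filter] at hω
          exact hω.2
  · -- high levels: `v^j ≤ v^h`, and the total mass is `≤ 1`
    calc ∑ j ∈ (Finset.range (k + 1)).filter (fun j => ¬ j < h),
          v ^ j * μ.real {ω : BondConfig (Fin n) | M ω = j}
        ≤ ∑ j ∈ (Finset.range (k + 1)).filter (fun j => ¬ j < h),
            v ^ h * μ.real {ω : BondConfig (Fin n) | M ω = j} := by
          refine Finset.sum_le_sum fun j hj => ?_
          have hjh : h ≤ j := not_lt.1 (Finset.mem_filter.1 hj).2
          exact mul_le_mul_of_nonneg_right (pow_le_pow_of_le_one hv0 hv1 hjh) measureReal_nonneg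
      _ = v ^ h * μ.real {ω : BondConfig (Fin n) |
            M ω ∈ (Finset.range (k + 1)).filter (fun j => ¬ j < h)} := by
          rw [← Finset.mul_sum, sum_measureReal_level_eq μ M _]
      _ ≤ v ^ h * 1 := mul_le_mul_of_nonneg_left measureReal_le_one (pow_nonneg hv0 h)
      _ = v ^ h := mul_one _

/-- `P(x ↮ x) = 0 ≤ τ`: the diagonal case of the pairwise hypothesis, needed by
`Theorems.smallBlock_le_two_mul`. -/
theorem measureReal_compl_openConn_self_le {n : ℕ} (w : Sym2 (Fin n) → unitInterval) (x : Fin n)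
    {τ : ℝ} (hτ : 0 ≤ τ) :
    (prodBernoulli w).real (openConn x x : Set (BondConfig (Fin n)))ᶜ ≤ τ := by
  have hself : (openConn x x : Set (BondConfig (Fin n))) = univ := by
    ext ω; simp [openConn]
  rw [hself, Set.compl_univ, measureReal_empty]
  exact hτ

end GeomMomentCIL

open GeomMomentCIL in
/-- **Geometric-moment CIL with ANY constant ⇒ `NoHeavyLowerTail`.**  If for some `C ≥ 0` every finite
weighted graph, every nonempty relay set `A`, every observer `o ∉ A` and every `v ∈ (0, 1]` admit a relay
`a ∈ A` with  `Σ_{j=1}^{|A|} v^j P(N = j) ≤ C · Σ_{j=0}^{|A|} v^j P(|π(a)| = j)`  — equivalently, event gluing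
with constant `C` towards a uniform virtual star sink on the relays — then the crux holds.  The relay may
depend on `v`. [this work] -/
theorem noHeavyLowerTail_of_geometricMomentCIL (C : ℝ) (hC : 0 ≤ C)
    (hGM : ∀ (n : ℕ) (w : Sym2 (Fin n) → unitInterval) (A : Finset (Fin n)) (o : Fin n) (v : ℝ),
      0 < v → v ≤ 1 → A.Nonempty → o ∉ A → ∃ a ∈ A,
        ∑ j ∈ Finset.Icc 1 A.card, v ^ j * (prodBernoulli w).real {ω : BondConfig (Fin n) |
            (A.filter fun x => ω ∈ openConn o x).card = j} ≤
          C * ∑ j ∈ Finset.range (A.card + 1), v ^ j * (prodBernoulli w).real {ω : BondConfig (Fin n) |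
            (A.filter fun x => ω ∈ openConn a x).card = j}) :
    Summit.CriticalPhenomena.PercolationContinuityZ3.Theses.PercNearOneGluing.NoHeavyLowerTail := by
  refine noHeavyLowerTail_of_oneCut_modulus fun ε hε => ?_
  -- constants: `C₁ = max C 1`, window height `s`, budget `τ`
  set C₁ : ℝ := max C 1 with hC₁def
  have hC₁1 : 1 ≤ C₁ := le_max_right _ _
  have hC₁0 : 0 < C₁ := by linarith
  have hCC₁ : C ≤ C₁ := le_max_left _ _
  set s : ℝ := min 1 (ε / (4 * C₁)) with hsdef
  have hs1 : s ≤ 1 := min_le_left _ _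
  have hsε : s ≤ ε / (4 * C₁) := min_le_right _ _
  have hs0 : 0 < s := lt_min one_pos (by positivity)
  have hC₁s : C₁ * s ≤ ε / 4 := by
    calc C₁ * s ≤ C₁ * (ε / (4 * C₁)) := mul_le_mul_of_nonneg_left hsε hC₁0.le
      _ = ε / 4 := by field_simp
  set τ : ℝ := ε * s / (8 * C₁) with hτdef
  have hτ0 : 0 < τ := by positivity
  have hτε : 2 * τ ≤ ε := by
    -- `2τ = ε s /(4 C₁) ≤ ε` since `s ≤ 1 ≤ 4 C₁`
    have h1 : ε * s ≤ ε * (4 * C₁) := by nlinarith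
    have h2 : 2 * τ = ε * s / (4 * C₁) := by rw [hτdef]; ring
    rw [h2, div_le_iff₀ (by positivity)]
    exact h1
  refine ⟨1 / 4, τ, by norm_num, hτ0, fun n w A o hpair hU => ?_⟩
  set μ := prodBernoulli w with hμ
  -- pairwise hypothesis including the diagonal
  have hpair' : ∀ a ∈ A, ∀ a' ∈ A, μ.real (openConn a a' : Set (BondConfig (Fin n)))ᶜ ≤ τ := by
    intro a ha a' ha'
    by_cases h : a = a'
    · subst h; exact measureReal_compl_openConn_self_le w a hτ0.le
    · exact hpair a ha a' ha' h
  -- `E N ≤ k`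
  have hEN : ∑ a ∈ A, μ.real (openConn o a : Set (BondConfig (Fin n))) ≤ A.card := by
    calc ∑ a ∈ A, μ.real (openConn o a : Set (BondConfig (Fin n))) ≤ ∑ a ∈ A, (1 : ℝ) :=
          Finset.sum_le_sum fun a _ => measureReal_le_one
      _ = A.card := by simp
  -- the crux window at `ρ = 1/4` lies inside the integer window `1 ≤ N ≤ ⌊k/4⌋`
  set J : ℕ := A.card / 4 with hJdef
  set T : Set (BondConfig (Fin n)) := {ω : BondConfig (Fin n) |
      1 ≤ (A.filter fun x => ω ∈ openConn o x).card ∧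
        (A.filter fun x => ω ∈ openConn o x).card ≤ J} with hTdef
  have hsub : {ω : BondConfig (Fin n) | 1 ≤ (A.filter fun a => ω ∈ openConn o a).card ∧
        ((A.filter fun a => ω ∈ openConn o a).card : ℝ) <
          1 / 4 * (∑ a ∈ A, μ.real (openConn o a : Set (BondConfig (Fin n))))} ⊆ T := by
    intro ω hω
    simp only [Set.mem_setOf_eq] at hω
    refine ⟨hω.1, ?_⟩
    have hlt : ((A.filter fun a => ω ∈ openConn o a).card : ℝ) < 1 / 4 * (A.card : ℝ) :=
      lt_of_lt_of_le hω.2 (by nlinarith)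
    have h4 : (4 * (A.filter fun a => ω ∈ openConn o a).card : ℕ) < A.card := by
      have : (4 : ℝ) * ((A.filter fun a => ω ∈ openConn o a).card : ℝ) < (A.card : ℝ) := by linarith
      exact_mod_cast this
    rw [hJdef]; omega
  refine (measureReal_mono hsub (measure_ne_top _ _)).trans ?_
  -- Case 1: `J = 0` (i.e. `k ≤ 3`): the window is empty.
  by_cases hJ0 : J = 0
  · have hT : T = ∅ := by
      ext ω; simp only [hTdef, Set.mem_setOf_eq, Set.mem_empty_iff_false, iff_false, not_and, not_le]
      intro h1; omega
    rw [hT, measureReal_empty]; exact hε.le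
  have hJ1 : 1 ≤ J := Nat.one_le_iff_ne_zero.2 hJ0
  have hAcard : 4 ≤ A.card := by rw [hJdef] at hJ1; omega
  have hAne : A.Nonempty := Finset.card_pos.1 (by omega)
  -- Case 2: `o ∈ A`: then `N = |π(o)|` and pair counting at the relay `o` suffices.
  by_cases ho : o ∈ A
  · have hT2 : T ⊆ {ω : BondConfig (Fin n) | 2 * (A.filter fun a' => ω ∈ openConn o a').card ≤ A.card} := by
      intro ω hω
      simp only [hTdef, Set.mem_setOf_eq] at hω ⊢
      rw [hJdef] at hω; omega
    calc μ.real T ≤ μ.real {ω : BondConfig (Fin n) |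
          2 * (A.filter fun a' => ω ∈ openConn o a').card ≤ A.card} :=
          measureReal_mono hT2 (measure_ne_top _ _)
      _ ≤ 2 * τ := smallBlock_le_two_mul w A o τ ho (hpair' o ho)
      _ ≤ ε := hτε
  -- Case 3: `o ∉ A`, `k ≥ 4`: the geometric-moment argument with `v = s^{1/J}`.
  set v : ℝ := s ^ ((J : ℝ)⁻¹) with hvdef
  have hv0 : 0 < v := Real.rpow_pos_of_pos hs0 _
  have hv1 : v ≤ 1 := Real.rpow_le_one hs0.le hs1 (inv_nonneg.2 (Nat.cast_nonneg J))
  have hvJ : v ^ J = s := Real.rpow_inv_natCast_pow hs0.le hJ0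
  obtain ⟨a, ha, hle⟩ := hGM n w A o v hv0 hv1 hAne ho
  -- lower truncation of the left side
  have hlow := pow_mul_window_le_momentSum μ (fun ω => (A.filter fun x => ω ∈ openConn o x).card)
    v hv0.le hv1 J A.card (Nat.div_le_self _ _)
  -- upper truncation of the right side at `h = ⌊k/2⌋ + 1`
  set h : ℕ := A.card / 2 + 1 with hhdef
  have hup := momentSum_le_small_add_pow μ (fun ω => (A.filter fun x => ω ∈ openConn a x).card)
    v hv0.le hv1 A.card h
  have hsmall : μ.real {ω : BondConfig (Fin n) | (A.filter fun x => ω ∈ openConn a x).card < h} ≤ 2 * τ := by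
    have heq : {ω : BondConfig (Fin n) | (A.filter fun x => ω ∈ openConn a x).card < h} =
        {ω : BondConfig (Fin n) | 2 * (A.filter fun a' => ω ∈ openConn a a').card ≤ A.card} := by
      ext ω; simp only [Set.mem_setOf_eq, hhdef]; omega
    rw [heq]
    exact smallBlock_le_two_mul w A a τ ha (hpair' a ha)
  have hvh : v ^ h ≤ s * s := by
    have h2J : 2 * J ≤ h := by rw [hhdef, hJdef]; omega
    calc v ^ h ≤ v ^ (2 * J) := pow_le_pow_of_le_one hv0.le hv1 h2J
      _ = s * s := by rw [pow_mul', hvJ, sq]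
  -- assemble: `s · μ T ≤ C (2τ + s²) ≤ s · ε/2`
  have hchain : s * μ.real T ≤ C * (2 * τ + s * s) := by
    have e1 : v ^ J * μ.real T ≤ C * (μ.real {ω : BondConfig (Fin n) |
        (A.filter fun x => ω ∈ openConn a x).card < h} + v ^ h) :=
      (hlow.trans hle).trans (mul_le_mul_of_nonneg_left hup hC)
    rw [hvJ] at e1
    refine e1.trans (mul_le_mul_of_nonneg_left (add_le_add hsmall hvh) hC)
  have hkey : C * (2 * τ + s * s) ≤ s * (ε / 2) := by
    have h2τ : 2 * τ = ε * s / (4 * C₁) := by rw [hτdef]; ring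
    have hb0 : 0 ≤ 2 * τ + s * s := by positivity
    calc C * (2 * τ + s * s) ≤ C₁ * (2 * τ + s * s) := mul_le_mul_of_nonneg_right hCC₁ hb0
      _ = ε * s / 4 + (C₁ * s) * s := by rw [h2τ]; field_simp
      _ ≤ ε * s / 4 + (ε / 4) * s := by nlinarith [hC₁s, hs0.le]
      _ = s * (ε / 2) := by ring
  have hfin : μ.real T ≤ ε / 2 := le_of_mul_le_mul_left (hchain.trans hkey) hs0
  linarith

open GeomMomentCIL in
/-- **Geometric-moment CIL with ANY constant and the OBSERVER BUDGET ⇒ `NoHeavyLowerTail`.**  The same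
reduction when the hypothesis may also spend the observer's own disconnection probability `P(o ↮ A)`:
if for some `C ≥ 0` every graph, nonempty `A`, `o ∉ A` and `v ∈ (0,1]` admit `a ∈ A` with
`Σ_{j≥1} v^j P(N = j) ≤ C · (Σ_{j≥0} v^j P(|π(a)| = j) + P(o ↮ A))`, then the crux holds (the budget `P(o ↮ A) ≤ τ`
is part of the one-cut modulus hypotheses; `τ/s → 0`).  This is the socket for arguments that use the
van den Berg–Kahn disjoint-pocket inequality or any other `δ₀ = P(o ↮ A)`-lossy step. [this work] -/
theorem noHeavyLowerTail_of_geometricMomentCIL_obs (C : ℝ) (hC : 0 ≤ C)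
    (hGM : ∀ (n : ℕ) (w : Sym2 (Fin n) → unitInterval) (A : Finset (Fin n)) (o : Fin n) (v : ℝ),
      0 < v → v ≤ 1 → A.Nonempty → o ∉ A → ∃ a ∈ A,
        ∑ j ∈ Finset.Icc 1 A.card, v ^ j * (prodBernoulli w).real {ω : BondConfig (Fin n) |
            (A.filter fun x => ω ∈ openConn o x).card = j} ≤
          C * (∑ j ∈ Finset.range (A.card + 1), v ^ j * (prodBernoulli w).real {ω : BondConfig (Fin n) |
            (A.filter fun x => ω ∈ openConn a x).card = j} +
            (prodBernoulli w).real (⋃ a ∈ A, (openConn o a : Set (BondConfig (Fin n))))ᶜ)) :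
    Summit.CriticalPhenomena.PercolationContinuityZ3.Theses.PercNearOneGluing.NoHeavyLowerTail := by
  refine noHeavyLowerTail_of_oneCut_modulus fun ε hε => ?_
  set C₁ : ℝ := max C 1 with hC₁def
  have hC₁1 : 1 ≤ C₁ := le_max_right _ _
  have hC₁0 : 0 < C₁ := by linarith
  have hCC₁ : C ≤ C₁ := le_max_left _ _
  set s : ℝ := min 1 (ε / (4 * C₁)) with hsdef
  have hs1 : s ≤ 1 := min_le_left _ _
  have hsε : s ≤ ε / (4 * C₁) := min_le_right _ _
  have hs0 : 0 < s := lt_min one_pos (by positivity)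
  have hC₁s : C₁ * s ≤ ε / 4 := by
    calc C₁ * s ≤ C₁ * (ε / (4 * C₁)) := mul_le_mul_of_nonneg_left hsε hC₁0.le
      _ = ε / 4 := by field_simp
  -- budget `τ` one third smaller than in the plain version: the hypothesis spends `2τ + τ`
  set τ : ℝ := ε * s / (12 * C₁) with hτdef
  have hτ0 : 0 < τ := by positivity
  have hτε : 2 * τ ≤ ε := by
    have h1 : ε * s ≤ ε * (6 * C₁) := by nlinarith
    have h2 : 2 * τ = ε * s / (6 * C₁) := by rw [hτdef]; ring
    rw [h2, div_le_iff₀ (by positivity)]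
    exact h1
  refine ⟨1 / 4, τ, by norm_num, hτ0, fun n w A o hpair hU => ?_⟩
  set μ := prodBernoulli w with hμ
  have hpair' : ∀ a ∈ A, ∀ a' ∈ A, μ.real (openConn a a' : Set (BondConfig (Fin n)))ᶜ ≤ τ := by
    intro a ha a' ha'
    by_cases h : a = a'
    · subst h; exact measureReal_compl_openConn_self_le w a hτ0.le
    · exact hpair a ha a' ha' h
  have hEN : ∑ a ∈ A, μ.real (openConn o a : Set (BondConfig (Fin n))) ≤ A.card := by
    calc ∑ a ∈ A, μ.real (openConn o a : Set (BondConfig (Fin n))) ≤ ∑ a ∈ A, (1 : ℝ) :=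
          Finset.sum_le_sum fun a _ => measureReal_le_one
      _ = A.card := by simp
  set J : ℕ := A.card / 4 with hJdef
  set T : Set (BondConfig (Fin n)) := {ω : BondConfig (Fin n) |
      1 ≤ (A.filter fun x => ω ∈ openConn o x).card ∧
        (A.filter fun x => ω ∈ openConn o x).card ≤ J} with hTdef
  have hsub : {ω : BondConfig (Fin n) | 1 ≤ (A.filter fun a => ω ∈ openConn o a).card ∧
        ((A.filter fun a => ω ∈ openConn o a).card : ℝ) <
          1 / 4 * (∑ a ∈ A, μ.real (openConn o a : Set (BondConfig (Fin n))))} ⊆ T := by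
    intro ω hω
    simp only [Set.mem_setOf_eq] at hω
    refine ⟨hω.1, ?_⟩
    have hlt : ((A.filter fun a => ω ∈ openConn o a).card : ℝ) < 1 / 4 * (A.card : ℝ) :=
      lt_of_lt_of_le hω.2 (by nlinarith)
    have h4 : (4 * (A.filter fun a => ω ∈ openConn o a).card : ℕ) < A.card := by
      have : (4 : ℝ) * ((A.filter fun a => ω ∈ openConn o a).card : ℝ) < (A.card : ℝ) := by linarith
      exact_mod_cast this
    rw [hJdef]; omega
  refine (measureReal_mono hsub (measure_ne_top _ _)).trans ?_
  by_cases hJ0 : J = 0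
  · have hT : T = ∅ := by
      ext ω; simp only [hTdef, Set.mem_setOf_eq, Set.mem_empty_iff_false, iff_false, not_and, not_le]
      intro h1; omega
    rw [hT, measureReal_empty]; exact hε.le
  have hJ1 : 1 ≤ J := Nat.one_le_iff_ne_zero.2 hJ0
  have hAcard : 4 ≤ A.card := by rw [hJdef] at hJ1; omega
  have hAne : A.Nonempty := Finset.card_pos.1 (by omega)
  by_cases ho : o ∈ A
  · have hT2 : T ⊆ {ω : BondConfig (Fin n) | 2 * (A.filter fun a' => ω ∈ openConn o a').card ≤ A.card} := by
      intro ω hω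
      simp only [hTdef, Set.mem_setOf_eq] at hω ⊢
      rw [hJdef] at hω; omega
    calc μ.real T ≤ μ.real {ω : BondConfig (Fin n) |
          2 * (A.filter fun a' => ω ∈ openConn o a').card ≤ A.card} :=
          measureReal_mono hT2 (measure_ne_top _ _)
      _ ≤ 2 * τ := smallBlock_le_two_mul w A o τ ho (hpair' o ho)
      _ ≤ ε := hτε
  set v : ℝ := s ^ ((J : ℝ)⁻¹) with hvdef
  have hv0 : 0 < v := Real.rpow_pos_of_pos hs0 _
  have hv1 : v ≤ 1 := Real.rpow_le_one hs0.le hs1 (inv_nonneg.2 (Nat.cast_nonneg J))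
  have hvJ : v ^ J = s := Real.rpow_inv_natCast_pow hs0.le hJ0
  obtain ⟨a, ha, hle⟩ := hGM n w A o v hv0 hv1 hAne ho
  have hlow := pow_mul_window_le_momentSum μ (fun ω => (A.filter fun x => ω ∈ openConn o x).card)
    v hv0.le hv1 J A.card (Nat.div_le_self _ _)
  set h : ℕ := A.card / 2 + 1 with hhdef
  have hup := momentSum_le_small_add_pow μ (fun ω => (A.filter fun x => ω ∈ openConn a x).card)
    v hv0.le hv1 A.card h
  have hsmall : μ.real {ω : BondConfig (Fin n) | (A.filter fun x => ω ∈ openConn a x).card < h} ≤ 2 * τ := by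
    have heq : {ω : BondConfig (Fin n) | (A.filter fun x => ω ∈ openConn a x).card < h} =
        {ω : BondConfig (Fin n) | 2 * (A.filter fun a' => ω ∈ openConn a a').card ≤ A.card} := by
      ext ω; simp only [Set.mem_setOf_eq, hhdef]; omega
    rw [heq]
    exact smallBlock_le_two_mul w A a τ ha (hpair' a ha)
  have hvh : v ^ h ≤ s * s := by
    have h2J : 2 * J ≤ h := by rw [hhdef, hJdef]; omega
    calc v ^ h ≤ v ^ (2 * J) := pow_le_pow_of_le_one hv0.le hv1 h2J
      _ = s * s := by rw [pow_mul', hvJ, sq]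
  -- the observer budget
  have hobs : μ.real (⋃ a ∈ A, (openConn o a : Set (BondConfig (Fin n))))ᶜ ≤ τ := hU
  have hchain : s * μ.real T ≤ C * (2 * τ + s * s + τ) := by
    have e1 : v ^ J * μ.real T ≤ C * (μ.real {ω : BondConfig (Fin n) |
        (A.filter fun x => ω ∈ openConn a x).card < h} + v ^ h +
          μ.real (⋃ a ∈ A, (openConn o a : Set (BondConfig (Fin n))))ᶜ) := by
      refine (hlow.trans hle).trans (mul_le_mul_of_nonneg_left ?_ hC)
      linarith [hup]
    rw [hvJ] at e1
    refine e1.trans (mul_le_mul_of_nonneg_left ?_ hC)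
    linarith [hsmall, hvh, hobs]
  have hkey : C * (2 * τ + s * s + τ) ≤ s * (ε / 2) := by
    have h3τ : 2 * τ + τ = ε * s / (4 * C₁) := by rw [hτdef]; ring
    have hb0 : 0 ≤ 2 * τ + s * s + τ := by positivity
    calc C * (2 * τ + s * s + τ) ≤ C₁ * (2 * τ + s * s + τ) := mul_le_mul_of_nonneg_right hCC₁ hb0
      _ = C₁ * ((2 * τ + τ) + s * s) := by ring
      _ = ε * s / 4 + (C₁ * s) * s := by rw [h3τ]; field_simp
      _ ≤ ε * s / 4 + (ε / 4) * s := by nlinarith [hC₁s, hs0.le]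
      _ = s * (ε / 2) := by ring
  have hfin : μ.real T ≤ ε / 2 := le_of_mul_le_mul_left (hchain.trans hkey) hs0
  linarith
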